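import Summits.RiemannHypothesis.RiemannHypothesis.Theorems.GroundBartaPolarPerronFrobeniusSourceBound
import Summits.RiemannHypothesis.RiemannHypothesis.Theorems.GroundBartaPolarPerronFrobeniusEvenLimit
import HarnessLib

/-!
# RiemannHypothesis / GroundBarta — crux `PolarPerronFrobenius` (stmt-RiemannHypothesis-18390):
# the source criterion, part S2: untruncated inner identities, limits along the approximants

Helper file (`--supports stmt-RiemannHypothesis-18390`), RH-free, Mathlib + proved tree files only,
no definitions, no named facts.  Notation: `f` real smooth, `supp f ⊆ [-a, a]`, `p = f⁺`, `n = f⁻`,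
`F = f`, `A = |f|`, `W_η = ψ_η ∘ f`, `D_t = weilIncrement`, `w = weilArchDensity`.

* `swu_inner_eq` (at a point with `f(x) < 0`): `∫ w(|t|)(p(x+t) + p(x−t)) dt = 2∫ w(|x−y|) p(y) dy`
  (the integrands are bounded by `L²ae^{a}/n(x)` thanks to the zero of `f` between `x` and `supp p`);
  `swu_inner_even`: for even `f`, `2∫ w(|x−y|)p(y)dy = ∫ (w(|x−y|) + w(|x+y|)) p(y) dy`;
* `swu_two_mul_setIntegral_eq`: `2∫_{(0,∞)} w·G = ∫_ℝ w(|t|) G(t) dt` for even `G`;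
* `swu_weilDirichletEnergy_sub_eq`: the EXACT energy bookkeeping
  `𝓔_a(W_η) − 𝓔_a(F) = −Σ_n Λ(n)n^{-1/2}(D_{log n}F − D_{log n}W_η) − ∫_{(0,∞)} w (D_t F − D_t W_η) dt`;
* `swu_tendsto_archGain`, `swu_tendsto_primeGain`: both gains converge as `η → 0⁺` to the same
  expressions with `A = |f|` in place of `W_η` (dominated convergence / finite sums).

Prover B, speedrun unit `sr-gb-rung-b` (seat 2).
-/

set_option linter.dupNamespace false

noncomputable section

open Set MeasureTheory Filter Complex
open scoped Real Topology

namespace Summit.RiemannHypothesis.RiemannHypothesis.Theorems.PolarPerronFrobenius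

open Literature.NumberTheory.LFunctions
open scoped ArithmeticFunction.vonMangoldt

/-! ## Inner identities with the untruncated kernel -/

section Inner

variable {f : ℝ → ℝ} {a : ℝ}

/-- At a point `x` with `f(x) < 0`, the functions `y ↦ w(|x−y|) f⁺(y)`-type are bounded:
`w(|x − y|) f⁺(y) ≤ L²ae^{a} / f⁻(x)`. [folklore] -/
theorem swu_kernel_posPart_le (hfc : Continuous f) {L : ℝ} (hL0 : 0 ≤ L)
    (hL : ∀ x y, |f x - f y| ≤ L * |x - y|) (ha : 0 < a) (hsupp : Function.support f ⊆ Icc (-a) a)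
    {x : ℝ} (hx : f x < 0) (y : ℝ) :
    weilArchDensity |x - y| * max (f y) 0 ≤ L ^ 2 * (a * Real.exp a) / max (-f x) 0 := by
  have hn : 0 < max (-f x) 0 := by rw [max_eq_left (by linarith)]; linarith
  rw [le_div_iff₀ hn]
  have h := swu_kernelProd_le hfc hL0 hL ha hsupp y x
  rw [abs_sub_comm] at h
  calc weilArchDensity |x - y| * max (f y) 0 * max (-f x) 0
      = weilArchDensity |x - y| * (max (f y) 0 * max (-f x) 0) := by ring
    _ ≤ L ^ 2 * (a * Real.exp a) := h

/-- **Translation (untruncated)**: at `x` with `f(x) < 0`,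
`∫ w(|t|)(f⁺(x+t) + f⁺(x−t)) dt = 2∫ w(|x−y|) f⁺(y) dy`. [folklore] -/
theorem swu_inner_eq (hf : ContDiff ℝ (⊤ : ℕ∞) f) (hfs : HasCompactSupport f) (ha : 0 < a)
    (hsupp : Function.support f ⊆ Icc (-a) a) {x : ℝ} (hx : f x < 0) :
    ∫ t, weilArchDensity |t| * (max (f (x + t)) 0 + max (f (x - t)) 0) =
      2 * ∫ y, weilArchDensity |x - y| * max (f y) 0 := by
  have hfc : Continuous f := hf.continuous
  have hp : Continuous fun x ↦ max (f x) 0 := hfc.max continuous_const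
  have hps := swe_hasCompactSupport_posPart hfs
  obtain ⟨L, hL0, hL⟩ := swu_exists_lipschitz hf hfs
  set C : ℝ := L ^ 2 * (a * Real.exp a) / max (-f x) 0 with hC
  have hC0 : 0 ≤ C := by
    have : 0 < max (-f x) 0 := by rw [max_eq_left (by linarith)]; linarith
    positivity
  -- the basic integrable function `y ↦ w(|x-y|) f⁺(y)`: bounded by `C`, supported in `[-a, a]`
  have hbase : Integrable fun y ↦ weilArchDensity |x - y| * max (f y) 0 := by
    have hmeas : AEStronglyMeasurable (fun y ↦ weilArchDensity |x - y| * max (f y) 0) volume :=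
      ((swu_measurable_kernel.comp (measurable_const.sub measurable_id)).mul
        hp.measurable).aestronglyMeasurable
    refine Integrable.mono' ((integrable_indicator_iff measurableSet_Icc).2
      (integrableOn_const (by simp) : IntegrableOn (fun _ ↦ C) (Icc (-a) a))) hmeas
      (Eventually.of_forall fun y ↦ ?_)
    have h0 : 0 ≤ weilArchDensity |x - y| * max (f y) 0 :=
      mul_nonneg (GroundBartaFloor.weilArchDensity_abs_nonneg _) (le_max_right _ _)
    rw [Real.norm_of_nonneg h0]
    by_cases hy : y ∈ Icc (-a) a
    · rw [Set.indicator_of_mem hy]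
      exact swu_kernel_posPart_le hfc hL0 hL ha hsupp hx y
    · have hfy : f y = 0 := by
        by_contra hne; exact hy (hsupp (Function.mem_support.2 hne))
      rw [hfy, max_self, mul_zero, Set.indicator_of_notMem hy]
  -- `∫ w(|t|) f⁺(x+t) dt = ∫ w(|x-y|) f⁺(y) dy`
  have e1 : ∫ t, weilArchDensity |t| * max (f (x + t)) 0 =
      ∫ y, weilArchDensity |x - y| * max (f y) 0 := by
    have h := integral_add_right_eq_self (μ := volume)
      (fun y ↦ weilArchDensity |x - y| * max (f y) 0) x
    rw [← h]
    refine integral_congr_ae (Eventually.of_forall fun t ↦ ?_)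
    simp only
    rw [show x - (t + x) = -t by ring, abs_neg, add_comm t x]
  have e2 : ∫ t, weilArchDensity |t| * max (f (x - t)) 0 =
      ∫ y, weilArchDensity |x - y| * max (f y) 0 := by
    have h := integral_sub_left_eq_self (fun y ↦ weilArchDensity |x - y| * max (f y) 0) volume x
    rw [← h]
    refine integral_congr_ae (Eventually.of_forall fun t ↦ ?_)
    simp only
    rw [show x - (x - t) = t by ring]
  -- integrability of the two translated pieces (as translates of `hbase`)
  have i1 : Integrable fun t ↦ weilArchDensity |t| * max (f (x + t)) 0 := by
    have h := hbase.comp_add_right x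
    refine h.congr (Eventually.of_forall fun t ↦ ?_)
    simp only
    rw [show x - (t + x) = -t by ring, abs_neg, add_comm t x]
  have i2 : Integrable fun t ↦ weilArchDensity |t| * max (f (x - t)) 0 := by
    have h := hbase.comp_sub_left x
    refine h.congr (Eventually.of_forall fun t ↦ ?_)
    simp only
    rw [show x - (x - t) = t by ring]
  calc ∫ t, weilArchDensity |t| * (max (f (x + t)) 0 + max (f (x - t)) 0)
      = ∫ t, (weilArchDensity |t| * max (f (x + t)) 0 + weilArchDensity |t| * max (f (x - t)) 0) := by
        refine integral_congr_ae (Eventually.of_forall fun t ↦ ?_); simp only; ring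
    _ = (∫ t, weilArchDensity |t| * max (f (x + t)) 0) + ∫ t, weilArchDensity |t| * max (f (x - t)) 0 :=
        integral_add i1 i2
    _ = 2 * ∫ y, weilArchDensity |x - y| * max (f y) 0 := by rw [e1, e2]; ring

/-- **Reflection (untruncated)** for even `f`, at `x` with `f(x) < 0`:
`2∫ w(|x−y|) f⁺(y) dy = ∫ (w(|x−y|) + w(|x+y|)) f⁺(y) dy`. [folklore] -/
theorem swu_inner_even (hf : ContDiff ℝ (⊤ : ℕ∞) f) (hfs : HasCompactSupport f) (ha : 0 < a)
    (hsupp : Function.support f ⊆ Icc (-a) a) (hfe : ∀ t, f (-t) = f t) {x : ℝ} (hx : f x < 0) :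
    2 * ∫ y, weilArchDensity |x - y| * max (f y) 0 =
      ∫ y, (weilArchDensity |x - y| + weilArchDensity |x + y|) * max (f y) 0 := by
  have hfc : Continuous f := hf.continuous
  have hp : Continuous fun x ↦ max (f x) 0 := hfc.max continuous_const
  obtain ⟨L, hL0, hL⟩ := swu_exists_lipschitz hf hfs
  set C : ℝ := L ^ 2 * (a * Real.exp a) / max (-f x) 0 with hC
  have hx' : f (-x) < 0 := by rwa [hfe]
  -- integrability of both kernel pairings
  have hint : ∀ z : ℝ, f z < 0 → Integrable fun y ↦ weilArchDensity |z - y| * max (f y) 0 := by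
    intro z hz
    have hmeas : AEStronglyMeasurable (fun y ↦ weilArchDensity |z - y| * max (f y) 0) volume :=
      ((swu_measurable_kernel.comp (measurable_const.sub measurable_id)).mul
        hp.measurable).aestronglyMeasurable
    refine Integrable.mono' ((integrable_indicator_iff measurableSet_Icc).2
      (integrableOn_const (by simp) :
        IntegrableOn (fun _ ↦ L ^ 2 * (a * Real.exp a) / max (-f z) 0) (Icc (-a) a))) hmeas
      (Eventually.of_forall fun y ↦ ?_)
    have h0 : 0 ≤ weilArchDensity |z - y| * max (f y) 0 :=
      mul_nonneg (GroundBartaFloor.weilArchDensity_abs_nonneg _) (le_max_right _ _)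
    rw [Real.norm_of_nonneg h0]
    by_cases hy : y ∈ Icc (-a) a
    · rw [Set.indicator_of_mem hy]
      exact swu_kernel_posPart_le hfc hL0 hL ha hsupp hz y
    · have hfy : f y = 0 := by
        by_contra hne; exact hy (hsupp (Function.mem_support.2 hne))
      rw [hfy, max_self, mul_zero, Set.indicator_of_notMem hy]
  have i1 := hint x hx
  have i2 : Integrable fun y ↦ weilArchDensity |x + y| * max (f y) 0 := by
    refine (hint (-x) hx').congr (Eventually.of_forall fun y ↦ ?_)
    simp only
    rw [show -x - y = -(x + y) by ring, abs_neg]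
  have e : ∫ y, weilArchDensity |x - y| * max (f y) 0 = ∫ y, weilArchDensity |x + y| * max (f y) 0 := by
    have h := integral_neg_eq_self (fun y ↦ weilArchDensity |x - y| * max (f y) 0) volume
    rw [← h]
    refine integral_congr_ae (Eventually.of_forall fun y ↦ ?_)
    simp only
    rw [sub_neg_eq_add, hfe]
  rw [two_mul]
  nth_rewrite 2 [e]
  rw [← integral_add i1 i2]
  refine integral_congr_ae (Eventually.of_forall fun y ↦ ?_)
  simp only
  ring

end Inner

/-! ## From `(0, ∞)` to `ℝ`; exact energy bookkeeping; limits along the approximants -/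

section Limits

variable {f : ℝ → ℝ} {a η : ℝ}

/-- For an even `G`: `2∫_{(0,∞)} w(t) G(t) dt = ∫_ℝ w(|t|) G(t) dt` (`integral_comp_abs`). [folklore] -/
theorem swu_two_mul_setIntegral_eq {G : ℝ → ℝ} (hG : ∀ t, G (-t) = G t) :
    2 * ∫ t in Ioi (0 : ℝ), weilArchDensity t * G t = ∫ t, weilArchDensity |t| * G t := by
  have h := integral_comp_abs (f := fun s ↦ weilArchDensity s * G s)
  rw [← h]
  refine integral_congr_ae (Eventually.of_forall fun t ↦ ?_)
  simp only
  congr 1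
  rcases le_total 0 t with ht | ht
  · rw [abs_of_nonneg ht]
  · rw [abs_of_nonpos ht, hG]

/-- **Exact energy bookkeeping along the approximants** (`η > 0`):
`𝓔_a(W_η) − 𝓔_a(F) = −Σ_{n∈I_a} Λ(n)n^{-1/2}(D_{log n}F − D_{log n}W_η) − ∫_{(0,∞)} w (D_t F − D_t W_η) dt`.
[folklore] -/
theorem swu_weilDirichletEnergy_sub_eq (hf : ContDiff ℝ (⊤ : ℕ∞) f) (hfs : HasCompactSupport f)
    (a : ℝ) (hη : 0 < η) :
    weilDirichletEnergy a (fun x ↦ ((Real.sqrt (f x ^ 2 + η ^ 2) - η : ℝ) : ℂ)) -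
        weilDirichletEnergy a (fun x ↦ ((f x : ℝ) : ℂ)) =
      -(∑ n ∈ weilPrimeIndex a, (Λ n : ℝ) / Real.sqrt n *
          (weilIncrement (fun x ↦ ((f x : ℝ) : ℂ)) (Real.log n) -
            weilIncrement (fun x ↦ ((Real.sqrt (f x ^ 2 + η ^ 2) - η : ℝ) : ℂ)) (Real.log n))) -
        ∫ t in Ioi (0 : ℝ), weilArchDensity t *
          (weilIncrement (fun x ↦ ((f x : ℝ) : ℂ)) t -
            weilIncrement (fun x ↦ ((Real.sqrt (f x ^ 2 + η ^ 2) - η : ℝ) : ℂ)) t) := by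
  set W : ℝ → ℂ := fun x ↦ ((Real.sqrt (f x ^ 2 + η ^ 2) - η : ℝ) : ℂ) with hWdef
  set F : ℝ → ℂ := fun x ↦ ((f x : ℝ) : ℂ) with hFdef
  have hF : IsWeilTest F := sw_isWeilTest_ofReal_comp hf hfs
  have hW : IsWeilTest W := sw_isWeilTest_psi_comp hf hfs hη
  have iF := integrableOn_weilArchDensity_mul_weilIncrement hF
  have iW := integrableOn_weilArchDensity_mul_weilIncrement hW
  have harch : ∫ t in Ioi (0 : ℝ), weilArchDensity t * (weilIncrement F t - weilIncrement W t) =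
      (∫ t in Ioi (0 : ℝ), weilArchDensity t * weilIncrement F t) -
        ∫ t in Ioi (0 : ℝ), weilArchDensity t * weilIncrement W t := by
    rw [← integral_sub iF iW]
    refine integral_congr_ae (Eventually.of_forall fun t ↦ ?_); simp only; ring
  have hprime : ∑ n ∈ weilPrimeIndex a, (Λ n : ℝ) / Real.sqrt n *
      (weilIncrement F (Real.log n) - weilIncrement W (Real.log n)) =
      (∑ n ∈ weilPrimeIndex a, (Λ n : ℝ) / Real.sqrt n * weilIncrement F (Real.log n)) -
        ∑ n ∈ weilPrimeIndex a, (Λ n : ℝ) / Real.sqrt n * weilIncrement W (Real.log n) := by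
    rw [← Finset.sum_sub_distrib]
    exact Finset.sum_congr rfl fun n _ ↦ by ring
  unfold weilDirichletEnergy
  rw [harch, hprime]
  ring

/-- **The archimedean gain converges** (untruncated): as `η → 0⁺`,
`∫_{(0,∞)} w (D_t F − D_t W_η) dt → ∫_{(0,∞)} w (D_t F − D_t |f|) dt` (dominated by `w · D_t F`). [folklore] -/
theorem swu_tendsto_archGain (hf : ContDiff ℝ (⊤ : ℕ∞) f) (hfs : HasCompactSupport f) :
    Tendsto (fun η : ℝ ↦ ∫ t in Ioi (0 : ℝ), weilArchDensity t *
        (weilIncrement (fun x ↦ ((f x : ℝ) : ℂ)) t -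
          weilIncrement (fun x ↦ ((Real.sqrt (f x ^ 2 + η ^ 2) - η : ℝ) : ℂ)) t))
      (𝓝[>] 0)
      (𝓝 (∫ t in Ioi (0 : ℝ), weilArchDensity t *
        (weilIncrement (fun x ↦ ((f x : ℝ) : ℂ)) t - weilIncrement (fun x ↦ ((|f x| : ℝ) : ℂ)) t))) := by
  set F : ℝ → ℂ := fun x ↦ ((f x : ℝ) : ℂ) with hFdef
  have hF : IsWeilTest F := sw_isWeilTest_ofReal_comp hf hfs
  have hev : ∀ᶠ η : ℝ in 𝓝[>] 0, 0 < η := self_mem_nhdsWithin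
  refine tendsto_integral_filter_of_dominated_convergence
    (fun t ↦ weilArchDensity t * weilIncrement F t) ?_ ?_
    (integrableOn_weilArchDensity_mul_weilIncrement hF) ?_
  · filter_upwards [hev] with η hη
    have hW : IsWeilTest fun x ↦ ((Real.sqrt (f x ^ 2 + η ^ 2) - η : ℝ) : ℂ) :=
      sw_isWeilTest_psi_comp hf hfs hη
    exact (measurable_weilArchDensity.mul
      ((continuous_weilIncrement hF).sub (continuous_weilIncrement hW)).measurable).aestronglyMeasurable
  · filter_upwards [hev] with η hη
    refine (ae_restrict_iff' measurableSet_Ioi).2 (Eventually.of_forall fun t (ht : 0 < t) ↦ ?_)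
    have hle := sw_weilIncrement_psi_comp_le hf hfs η t
    have hw0 := (weilArchDensity_pos ht).le
    have hD0 : 0 ≤ weilIncrement F t -
        weilIncrement (fun x ↦ ((Real.sqrt (f x ^ 2 + η ^ 2) - η : ℝ) : ℂ)) t := sub_nonneg.2 hle
    rw [Real.norm_of_nonneg (mul_nonneg hw0 hD0)]
    refine mul_le_mul_of_nonneg_left ?_ hw0
    linarith [weilIncrement_nonneg (fun x ↦ ((Real.sqrt (f x ^ 2 + η ^ 2) - η : ℝ) : ℂ)) t]
  · refine (ae_restrict_iff' measurableSet_Ioi).2 (Eventually.of_forall fun t _ ↦ ?_)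
    exact (tendsto_const_nhds.sub (swe_tendsto_weilIncrement_psi hf hfs t)).const_mul _

/-- **The prime gain converges**: as `η → 0⁺`,
`Σ_{n∈I_a} Λ(n)n^{-1/2}(D_{log n}F − D_{log n}W_η) → Σ_{n∈I_a} Λ(n)n^{-1/2}(D_{log n}F − D_{log n}|f|)`.
[folklore] -/
theorem swu_tendsto_primeGain (hf : ContDiff ℝ (⊤ : ℕ∞) f) (hfs : HasCompactSupport f) (a : ℝ) :
    Tendsto (fun η : ℝ ↦ ∑ n ∈ weilPrimeIndex a, (Λ n : ℝ) / Real.sqrt n *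
        (weilIncrement (fun x ↦ ((f x : ℝ) : ℂ)) (Real.log n) -
          weilIncrement (fun x ↦ ((Real.sqrt (f x ^ 2 + η ^ 2) - η : ℝ) : ℂ)) (Real.log n)))
      (𝓝[>] 0)
      (𝓝 (∑ n ∈ weilPrimeIndex a, (Λ n : ℝ) / Real.sqrt n *
        (weilIncrement (fun x ↦ ((f x : ℝ) : ℂ)) (Real.log n) -
          weilIncrement (fun x ↦ ((|f x| : ℝ) : ℂ)) (Real.log n)))) := by
  refine tendsto_finsetSum _ fun n _ ↦ ?_
  exact (tendsto_const_nhds.sub (swe_tendsto_weilIncrement_psi hf hfs (Real.log n))).const_mul _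

end Limits


end Summit.RiemannHypothesis.RiemannHypothesis.Theorems.PolarPerronFrobenius

end
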